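import Mathlib.Data.Set.Card
import Literature.Barriers.AtomisticToContinuum.ShortRangeStackingBlindness
import HarnessLib

/-!
# The first shells of the fcc stacking (Conway–Sloane, Ch. 4 §6.3): proof

Companion to `ShortRangeStackingBlindness.lean` (barrier catalogue
`Literature/Barriers/AtomisticToContinuum/`), which vendors the named fact
`Literature.Barriers.AtomisticToContinuum.ConwaySloane1999_fccShells`: around every point of the
ideal fcc stacking `fccStacking 1 √(2/3)` (`BarlowStacking.lean`: layers `…ABCABC…`, in-layer
spacing `1`, layer spacing `√(2/3)`) there are exactly `12, 6, 24, 12` points of the stacking at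
distances `1, √2, √3, 2`, and no other distance `≤ 2` occurs — the first coefficients of
`Θ_fcc = 1 + 12q² + 6q⁴ + 24q⁶ + ⋯` (Conway–Sloane, *Sphere Packings, Lattices and Groups*,
3rd ed., Ch. 4 §6.3 eq. (66), p. 113, and Table 4.5: `N(2) = 12, N(4) = 6, N(6) = 24, N(8) = 12`,
`N(m)` listed for even `m` only, `D₃` having minimal norm `2`; rescaled by `1/√2` to
nearest-neighbour distance `1`). This file **proves** it:
`ConwaySloane1999_fccShells_holds : ConwaySloane1999_fccShells` (axioms `propext`,
`Classical.choice`, `Quot.sound`). No statement is changed and no definition is introduced.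

## Proof

For the constant Hägg sequence the layer labels are `L k = k` (`haggLabel_const`), so the point
`(k, i, j)` of the stacking is `i u + j v + k (w + h e₃)`: the fcc stacking is the lattice with
basis `u, v, t = w + h e₃`, three unit vectors at mutual angle `π/3` (minimal vectors of
`A₃ ≅ D₃`, Conway–Sloane Ch. 4 §6.3). The tree's distance form `twelve_mul_dist_barlowPos_sq`
(`BarlowCoordination.lean`) specialises to the norm form of that lattice,
`dist² = P² + Q² + K² + PQ + PK + QK` (`dist_sq_fcc`), `P = i − i'`, `Q = j − j'`, `K = k − k'`.
Hence the shell of radius `r`, `r² = n`, around `(k, i, j)` is the injective image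
(`fcc_offset_injective`, from the packing property `le_dist_barlowPos_of_ideal`) of the integer
solution set `{(P, Q, K) | P² + Q² + K² + PQ + PK + QK = n}` (`fcc_inter_sphere_eq`,
`ncard_fcc_inter_sphere`). Since `12 (P² + Q² + K² + PQ + PK + QK) = (2P + 3Q + 3K)² + 3(Q − K)² + 8P²`,
a value `≤ 4` forces `|P|, |Q|, |K| ≤ 2` (`abs_le_two_of_fccNorm_le_four`), so for `n ≤ 4` the
solution set is a filter of the box `[-2, 2]³` (`fccNormShell_eq_filter`) and its cardinality
`12, 6, 24, 12` for `n = 1, 2, 3, 4` is computed by `decide` (`ncard_fccNorm_eq_one`, `…_two`,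
`…_three`, `…_four`). The last clause: `dist ≤ 2` gives an integer value `n ∈ {0, …, 4}` of the
form, and `dist = √n ∈ {0, 1, √2, √3, 2}` (`dist_fcc_mem_of_le_two`).

## References

* J. H. Conway, N. J. A. Sloane, *Sphere Packings, Lattices and Groups*, 3rd ed., Springer 1999:
  Ch. 1 §1.3 (p. 7: "…abcabc… produces the face-centered cubic lattice"); Ch. 4 §6.3
  (pp. 112–113), eq. (66) and Table 4.5.
-/

noncomputable section

open _root_.Literature.MathematicalPhysics.StatisticalMechanics

namespace Literature.Barriers.AtomisticToContinuum

/-! ## The norm form `P² + Q² + K² + PQ + PK + QK` of the fcc lattice and its first shells -/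

/-- `P² + Q² + K² + PQ + PK + QK ≤ 4 ⇒ |P| ≤ 2`, from
`12 (P² + Q² + K² + PQ + PK + QK) = (2P + 3Q + 3K)² + 3(Q − K)² + 8P²`. [folklore] -/
theorem abs_le_two_of_fccNorm_le_four {P Q K : ℤ}
    (h : P ^ 2 + Q ^ 2 + K ^ 2 + P * Q + P * K + Q * K ≤ 4) : -2 ≤ P ∧ P ≤ 2 := by
  have h8 : 8 * P ^ 2 ≤ 48 := by
    nlinarith [sq_nonneg (2 * P + 3 * Q + 3 * K), sq_nonneg (Q - K)]
  constructor <;> nlinarith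

/-- All three offsets of a solution of `P² + Q² + K² + PQ + PK + QK ≤ 4` lie in `[-2, 2]` (the
form is symmetric). [folklore] -/
theorem mem_box_of_fccNorm_le_four {P Q K : ℤ}
    (h : P ^ 2 + Q ^ 2 + K ^ 2 + P * Q + P * K + Q * K ≤ 4) :
    (-2 ≤ P ∧ P ≤ 2) ∧ (-2 ≤ Q ∧ Q ≤ 2) ∧ (-2 ≤ K ∧ K ≤ 2) :=
  ⟨abs_le_two_of_fccNorm_le_four h, abs_le_two_of_fccNorm_le_four (P := Q) (Q := P) (K := K)
    (by linarith), abs_le_two_of_fccNorm_le_four (P := K) (Q := P) (K := Q) (by linarith)⟩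

/-- For `n ≤ 4` the solution set of `P² + Q² + K² + PQ + PK + QK = n` is the corresponding
filter of the box `[-2, 2]³`. [folklore] -/
theorem fccNormShell_eq_filter {n : ℤ} (hn : n ≤ 4) :
    {t : ℤ × ℤ × ℤ | t.1 ^ 2 + t.2.1 ^ 2 + t.2.2 ^ 2 + t.1 * t.2.1 + t.1 * t.2.2 + t.2.1 * t.2.2 = n} =
      ↑((Finset.Icc (-2 : ℤ) 2 ×ˢ Finset.Icc (-2 : ℤ) 2 ×ˢ Finset.Icc (-2 : ℤ) 2).filter
        fun t : ℤ × ℤ × ℤ =>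
          t.1 ^ 2 + t.2.1 ^ 2 + t.2.2 ^ 2 + t.1 * t.2.1 + t.1 * t.2.2 + t.2.1 * t.2.2 = n) := by
  ext ⟨P, Q, K⟩
  simp only [Set.mem_setOf_eq, Finset.coe_filter, Finset.mem_product, Finset.mem_Icc]
  constructor
  · intro h
    exact ⟨mem_box_of_fccNorm_le_four (h ▸ hn), h⟩
  · exact fun h => h.2

/-- **`N(2) = 12` for `D₃`**: the form `P² + Q² + K² + PQ + PK + QK` represents `1` exactly twelve
times (the twelve nearest neighbours). [cite: ConwaySloane1999, Ch. 4 §6.3 (66), Table 4.5] -/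
theorem ncard_fccNorm_eq_one :
    {t : ℤ × ℤ × ℤ |
      t.1 ^ 2 + t.2.1 ^ 2 + t.2.2 ^ 2 + t.1 * t.2.1 + t.1 * t.2.2 + t.2.1 * t.2.2 = 1}.ncard = 12 := by
  rw [fccNormShell_eq_filter (by norm_num), Set.ncard_coe_finset]
  decide +kernel

/-- **`N(4) = 6` for `D₃`**: the form represents `2` exactly six times (second neighbours).
[cite: ConwaySloane1999, Ch. 4 §6.3 (66), Table 4.5] -/
theorem ncard_fccNorm_eq_two :
    {t : ℤ × ℤ × ℤ |
      t.1 ^ 2 + t.2.1 ^ 2 + t.2.2 ^ 2 + t.1 * t.2.1 + t.1 * t.2.2 + t.2.1 * t.2.2 = 2}.ncard = 6 := by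
  rw [fccNormShell_eq_filter (by norm_num), Set.ncard_coe_finset]
  decide +kernel

/-- **`N(6) = 24` for `D₃`**: the form represents `3` exactly twenty-four times (third
neighbours). [cite: ConwaySloane1999, Ch. 4 §6.3 (66), Table 4.5] -/
theorem ncard_fccNorm_eq_three :
    {t : ℤ × ℤ × ℤ |
      t.1 ^ 2 + t.2.1 ^ 2 + t.2.2 ^ 2 + t.1 * t.2.1 + t.1 * t.2.2 + t.2.1 * t.2.2 = 3}.ncard = 24 := by
  rw [fccNormShell_eq_filter (by norm_num), Set.ncard_coe_finset]
  decide +kernel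

/-- **`N(8) = 12` for `D₃`**: the form represents `4` exactly twelve times (fourth neighbours).
[cite: ConwaySloane1999, Ch. 4 §6.3, Table 4.5] -/
theorem ncard_fccNorm_eq_four :
    {t : ℤ × ℤ × ℤ |
      t.1 ^ 2 + t.2.1 ^ 2 + t.2.2 ^ 2 + t.1 * t.2.1 + t.1 * t.2.2 + t.2.1 * t.2.2 = 4}.ncard = 12 := by
  rw [fccNormShell_eq_filter (by norm_num), Set.ncard_coe_finset]
  decide +kernel

/-! ## The ideal fcc stacking is the fcc lattice: distances -/

/-- The ideal layer spacing: `(√(2/3))² = ⅔ · 1²`. [folklore] -/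
theorem sqrt_two_thirds_sq : (√(2 / 3) : ℝ) ^ 2 = 2 / 3 * 1 ^ 2 := by
  rw [Real.sq_sqrt (by norm_num)]; ring

/-- **Squared distances in the ideal fcc stacking are the values of the fcc norm form**:
`dist((k,i,j), (k',i',j'))² = P² + Q² + K² + PQ + PK + QK` with `P = i − i'`, `Q = j − j'`,
`K = k − k'` (the layer labels of `…ABC…` are `L k = k`). [cite: ConwaySloane1999, Ch. 4 §6.3] -/
theorem dist_sq_fcc (k i j k' i' j' : ℤ) :
    dist (barlowPos 1 (√(2 / 3)) constHagg k i j) (barlowPos 1 (√(2 / 3)) constHagg k' i' j') ^ 2 =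
      (((i - i') ^ 2 + (j - j') ^ 2 + (k - k') ^ 2 + (i - i') * (j - j') + (i - i') * (k - k') +
        (j - j') * (k - k') : ℤ) : ℝ) := by
  have h12 := twelve_mul_dist_barlowPos_sq sqrt_two_thirds_sq constHagg k i j k' i' j'
  simp only [haggLabel_const] at h12
  push_cast at h12 ⊢
  linear_combination h12 / 12

/-- `dist = r` iff the form takes the value `n`, for `0 ≤ r` and `n = r²`. [folklore] -/
theorem dist_fcc_eq_iff {k i j k' i' j' : ℤ} {r : ℝ} (hr : 0 ≤ r) {n : ℤ} (hn : (n : ℝ) = r ^ 2) :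
    dist (barlowPos 1 (√(2 / 3)) constHagg k' i' j') (barlowPos 1 (√(2 / 3)) constHagg k i j) = r ↔
      (i - i') ^ 2 + (j - j') ^ 2 + (k - k') ^ 2 + (i - i') * (j - j') + (i - i') * (k - k') +
        (j - j') * (k - k') = n := by
  rw [dist_comm, ← sq_eq_sq₀ dist_nonneg hr, dist_sq_fcc, ← hn, Int.cast_inj]

/-- The parametrisation of the fcc stacking by offsets `(P, Q, K)` from the point `(k, i, j)`,
`(P, Q, K) ↦ barlowPos (k − K) (i − P) (j − Q)`, is injective (distinct index triples give points
at distance `≥ 1`, `le_dist_barlowPos_of_ideal`). [folklore] -/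
theorem fcc_offset_injective (k i j : ℤ) :
    Function.Injective fun t : ℤ × ℤ × ℤ =>
      barlowPos 1 (√(2 / 3)) constHagg (k - t.2.2) (i - t.1) (j - t.2.1) := by
  intro t t' heq
  by_contra hne
  have hne' : (k - t.2.2, i - t.1, j - t.2.1) ≠ (k - t'.2.2, i - t'.1, j - t'.2.1) := by
    intro h0
    apply hne
    simp only [Prod.mk.injEq] at h0
    exact Prod.ext (by omega) (Prod.ext (by omega) (by omega))
  have h1 := le_dist_barlowPos_of_ideal isHaggSeq_const one_pos sqrt_two_thirds_sq hne'
  simp only at heq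
  rw [heq, dist_self] at h1
  linarith

/-- **The shell as a set**: for `0 ≤ r`, `r² = n`, the points of the fcc stacking at distance `r`
from `barlowPos k i j` are the images of the integer solutions of
`P² + Q² + K² + PQ + PK + QK = n` under the offset parametrisation. [folklore] -/
theorem fcc_inter_sphere_eq (k i j : ℤ) {r : ℝ} (hr : 0 ≤ r) {n : ℤ} (hn : (n : ℝ) = r ^ 2) :
    fccStacking 1 (√(2 / 3)) ∩ Metric.sphere (barlowPos 1 (√(2 / 3)) constHagg k i j) r =
      (fun t : ℤ × ℤ × ℤ => barlowPos 1 (√(2 / 3)) constHagg (k - t.2.2) (i - t.1) (j - t.2.1)) ''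
        {t : ℤ × ℤ × ℤ |
          t.1 ^ 2 + t.2.1 ^ 2 + t.2.2 ^ 2 + t.1 * t.2.1 + t.1 * t.2.2 + t.2.1 * t.2.2 = n} := by
  ext y
  simp only [Set.mem_inter_iff, Metric.mem_sphere, Set.mem_image, Set.mem_setOf_eq]
  constructor
  · rintro ⟨⟨k', i', j', rfl⟩, hd⟩
    exact ⟨(i - i', j - j', k - k'), (dist_fcc_eq_iff hr hn).1 hd, by simp⟩
  · rintro ⟨t, ht, rfl⟩
    refine ⟨barlowPos_mem _ _ _, (dist_fcc_eq_iff hr hn).2 ?_⟩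
    simpa using ht

/-- **Shell counts of the fcc stacking are representation numbers of the norm form.** [folklore] -/
theorem ncard_fcc_inter_sphere (k i j : ℤ) {r : ℝ} (hr : 0 ≤ r) {n : ℤ} (hn : (n : ℝ) = r ^ 2) :
    (fccStacking 1 (√(2 / 3)) ∩ Metric.sphere (barlowPos 1 (√(2 / 3)) constHagg k i j) r).ncard =
      {t : ℤ × ℤ × ℤ |
        t.1 ^ 2 + t.2.1 ^ 2 + t.2.2 ^ 2 + t.1 * t.2.1 + t.1 * t.2.2 + t.2.1 * t.2.2 = n}.ncard := by
  rw [fcc_inter_sphere_eq k i j hr hn, Set.ncard_image_of_injective _ (fcc_offset_injective k i j)]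

/-- `√4 = 2`. [folklore] -/
theorem sqrt_four_eq_two : √(4 : ℝ) = 2 := by
  rw [show (4 : ℝ) = 2 ^ 2 by norm_num]
  exact Real.sqrt_sq zero_le_two

/-- **No other distances `≤ 2`**: two points of the ideal fcc stacking at distance `≤ 2` are at
distance `0, 1, √2, √3` or `2` (the norm form is integer valued; `D₃` represents even norms
only). [cite: ConwaySloane1999, Ch. 4 §6.3, Table 4.5] -/
theorem dist_fcc_mem_of_le_two (k i j k' i' j' : ℤ)
    (hd : dist (barlowPos 1 (√(2 / 3)) constHagg k i j)
      (barlowPos 1 (√(2 / 3)) constHagg k' i' j') ≤ 2) :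
    dist (barlowPos 1 (√(2 / 3)) constHagg k i j) (barlowPos 1 (√(2 / 3)) constHagg k' i' j') ∈
      ({0, 1, √2, √3, 2} : Set ℝ) := by
  set d := dist (barlowPos 1 (√(2 / 3)) constHagg k i j) (barlowPos 1 (√(2 / 3)) constHagg k' i' j')
    with hd_def
  have hsq := dist_sq_fcc k i j k' i' j'
  rw [← hd_def] at hsq
  obtain ⟨n, hn⟩ : ∃ n : ℤ, (i - i') ^ 2 + (j - j') ^ 2 + (k - k') ^ 2 + (i - i') * (j - j') +
      (i - i') * (k - k') + (j - j') * (k - k') = n := ⟨_, rfl⟩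
  rw [hn] at hsq
  have h0 : 0 ≤ d := dist_nonneg
  have hn4 : n ≤ 4 := by
    have : (n : ℝ) ≤ 4 := by rw [← hsq]; nlinarith
    exact_mod_cast this
  have hn0 : 0 ≤ n := by
    have : (0 : ℝ) ≤ n := by rw [← hsq]; positivity
    exact_mod_cast this
  have hd_eq : d = √(n : ℝ) := by rw [← hsq, Real.sqrt_sq h0]
  simp only [Set.mem_insert_iff, Set.mem_singleton_iff]
  interval_cases n <;> simp [hd_eq, sqrt_four_eq_two]

/-! ## The fact -/

/-- **Proof of `ConwaySloane1999_fccShells`** (Conway–Sloane, Ch. 4 §6.3 eq. (66):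
`Θ_fcc = 1 + 12q² + 6q⁴ + 24q⁶ + ⋯`, Table 4.5: `N(8) = 12`, even norms only; `D₃` rescaled to
nearest-neighbour distance `1`; Ch. 1 §1.3: `…abcabc…` produces fcc): around every point of
`fccStacking 1 √(2/3)` there are exactly `12, 6, 24, 12` points of the stacking at distances
`1, √2, √3, 2`, and no other distance `≤ 2` occurs.
[cite: ConwaySloane1999, Ch. 4 §6.3 (66) and Table 4.5; Ch. 1 §1.3] -/
theorem ConwaySloane1999_fccShells_holds : ConwaySloane1999_fccShells := by
  rintro x ⟨k, i, j, rfl⟩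
  refine ⟨?_, ?_, ?_, ?_, ?_⟩
  · rw [ncard_fcc_inter_sphere k i j zero_le_one (n := 1) (by norm_num), ncard_fccNorm_eq_one]
  · rw [ncard_fcc_inter_sphere k i j (Real.sqrt_nonneg _) (n := 2)
        (by rw [Real.sq_sqrt (by norm_num)]; norm_num), ncard_fccNorm_eq_two]
  · rw [ncard_fcc_inter_sphere k i j (Real.sqrt_nonneg _) (n := 3)
        (by rw [Real.sq_sqrt (by norm_num)]; norm_num), ncard_fccNorm_eq_three]
  · rw [ncard_fcc_inter_sphere k i j zero_le_two (n := 4) (by norm_num), ncard_fccNorm_eq_four]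
  · rintro y ⟨k', i', j', rfl⟩ hd
    exact dist_fcc_mem_of_le_two k i j k' i' j' hd

end Literature.Barriers.AtomisticToContinuum

end
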